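import Literature.NumberTheory.EllipticCurves.Wang2016.CongruentShaTwoByTwo
import HarnessLib

/-!
# Wang 2016 (Sci. China Math. 59), *Congruent elliptic curves with non-trivial Shafarevich–Tate groups*, Thm. 1 AS PRINTED — the genus-divisor criterion for rank `0` and `Ш(E_n/ℚ)[2^∞] ≅ (ℤ/2ℤ)²` on the WIDER class (prime factors `≡ 1 (mod 4)`), and what it gives at the prime `2`

Sibling of `Wang2016/CongruentShaTwoByTwo.lean` (Thm. 3, second part; writer of record
`p2-monsky-lit`, p318976), importing its vocabulary (`Wang2016.eightTwoCard`) and re-declaring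
nothing of it (lead ruling L1-8, `p2/LEAD-OKS.md` 2026-08-22T05:08Z).

HONEST FRAMING (cell `b2b-bsdres`, sub-lane `bsd-p2`, run/shared/lean/b2b/bsd-rank1-residual/p2/;
literature typer 1, mandate (iv) "p = 2 literature layer typed AS PRINTED"; thread L-Ш4): ONE
PUBLISHED, REFEREED theorem vendored as a named `Prop` (nothing asserted, nothing discharged,
D-0014), every printed hypothesis a binder, chunk:line locators into the held text; plus bookkeeping
PROVED from tree theorems. The theorem is an ALGEBRAIC statement ABOUT the prime `2` (Monsky matrix
+ Cassels pairing on `Sel₂(E_n)/E_n[2]` + Gauss genus theory): inside an explicit family of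
square-free `n` it characterises exactly when `rank_ℤ E_n(ℚ) = 0` and `Ш(E_n/ℚ)[2^∞] ≅ (ℤ/2ℤ)²`.
No prime is excluded and no "`p` odd" occurs: ALLOWS-2 (indeed ABOUT 2). No `L`-value is mentioned:
the `2`-part of the BSD FORMULA is NOT claimed by the source. What the tree adds (§3, PROVED, no
new fact): the algebraic certificate "rank `0` ∧ `Ш[2^∞]` finite" for the CM curve `E_n` feeds
`bsdTriple_of_hasCM_of_mordellWeilRank_eq_zero_of_finite_shaPrimary` (Burungale–Tian, Ann. of
Math. 203 (2026) Thm. 1.1 at `p = 2` + Deuring–Hecke + Burungale–Flach, Camb. J. Math. 12 (2024)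
Cor. 2, named facts of the tree admitting `p = 2`), so on Wang's Thm. 1 family the FULL BSD
conjecture — in particular `BSD(E_n, 2)` with `#Ш(E_n)[2^∞] = 4` — holds CONDITIONALLY on three
named refereed facts; a DERIVED combination printed by no single paper. Thm. 1's class
{`n ≡ 1 (8)` square-free, all `p ∣ n` `≡ 1 (mod 4)`, `h₄(n) = 1`, genus criterion} CONTAINS the
Thm. 3 class of the sibling file (all `p ∣ n` `≡ 1 (mod 8)`, `h₄(n) = 1`, `h₈(n) = 0`).
EVIDENCE of what print says `2`-adically; nothing booked; no mark moved.

Source. Zhangjie Wang, *Congruent elliptic curves with non-trivial Shafarevich–Tate groups*,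
Sci. China Math. 59 (2016), no. 11, 2145–2166, doi 10.1007/s11425-015-0741-3 = arXiv:1511.03810
[Wang2016CongruentSha]. Text read: the held LaTeX-derived text `paper:arxiv-1511.03810` (16 chunks
`p0001`–`p0016`, no PDF pagination; locators are `chunk:line`).

## Printed notation (chunk p0003 L14, verbatim)

"For a positive square-free integer `n`, let `𝒜_n` denote the ideal class group of `K = ℚ(√−n)`
and `D` be the fundamental discriminant of `K`. We denote `𝒟` to be the set of all positive
square-free divisors of `D`. Then `𝒟` has a group structure. Gauss genus theory … implies that
there is a `2` to `1` correspondence `θ` between `𝒟 ∩ N(K^×)` and `𝒜_n[2] ∩ 2𝒜_n`. Here `N(K^×)`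
denotes the image of the norm map from `K^×` to `ℚ^×` … We define the `2^i`-rank `h_{2^i}(n)` of
`ℚ(√−n)` by `rank_{𝔽₂} 2^{i−1}𝒜_n/2^i𝒜_n` for `i ≥ 1`. Then we have
`h₄(n) = rank_{𝔽₂} 𝒜_n[2] ∩ 2𝒜_n`. If `h₄(n) = 1`, then there exist `d₁, d₂ ∈ 𝒟` corresponding to
the non-trivial element in `𝒜_n[2] ∩ 2𝒜_n`. Moreover if `n ≡ 1 (mod 8)` with all prime factors
congruent to `1 (mod 4)`, then the product of odd part `d_i'` of `d_i` equals `n`. This is because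
the kernel of `θ` is `{1, n}` in this case. Then we denote `d = d(n)` be the maximal integer of
`d₁', d₂'`."

## The printed theorem (verbatim) and the row-only ones

* **Theorem 1** (p0003 L18–L23). "Let `n` be a positive square-free integer congruent to
  `1 (mod 8)` with all prime factors congruent to `1 (mod 4)` distinct and `h₄(n) = 1`, then the
  following are equivalent: (i) `h₈(n) ≡ (d(n)−1)/4 (mod 2)`; (ii) `rank_ℤ E_n(ℚ) = 0` and
  `Ш(E_n/ℚ)[2^∞] ≃ (ℤ/2ℤ)²`." (`E_n : y² = x³ − n²x`, p0003 L5; proof = §4.1, p0010 L72 –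
  p0011 L100: Lemma 4 "`s₂(n) = 2` if and only if `h₄(n) = 1`" (p0010 L20–L22), the Cassels
  pairing on the two generators of `Sel₂(E_n)/E_n[2]`, and "Cassels pairing is non-degenerate … if
  and only if `h₈(n) ≡ (d−1)/4 (mod 2)`" (p0011 L97–L99).)
* ROW ONLY (not typed here): **Theorem 2** (p0003 L47–L60: `Ш(E_n/ℚ)[2^∞] ≃ (ℤ/2ℤ)^{2k}` under
  block conditions `h₄(d_i) = 1`, `h₈(d_i) = 0`, Legendre conditions, and `h₈(n) ∈ {k−1, k}`),
  Theorem 4 / Corollary 1 (p0014 L44–L106), and the first part of Theorem 3 (seven equivalent forms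
  of `δ_p = 1`; the second part is the sibling file's `thm3_rank_zero_and_sha_two_by_two`).

## What is typed, and how (tree dictionary)

* `h₄(n) = 1` ↦ `Tian2014.fourTwoCard (ClassGroup (𝓞 K)) = 2` (`#(𝒜[2] ∩ 2𝒜) = 2^{h₄}`) and
  `h₈(n)` ↦ `eightRank (ClassGroup (𝓞 K)) = log₂ (Wang2016.eightTwoCard …)`
  (`#(𝒜[2] ∩ 4𝒜) = 2^{h₈}`, the sibling file's count), for `K = ℚ(√−n)` rendered by
  `Tian2014.IsQuadraticFieldOfSqrt K (−n)` and quantified universally, exactly as in the sibling.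
* "(ii) `rank_ℤ E_n(ℚ) = 0` and `Ш(E_n/ℚ)[2^∞] ≃ (ℤ/2ℤ)²`" ↦ the same clause as the sibling's:
  `mordellWeilRank = 0 ∧ Nonempty (AddCommGroup.primaryComponent (congruentNumberCurve n).sha 2 ≃+ ZMod 2 × ZMod 2)`.
* Theorem 1's `d(n)` ↦ a binder `d ∣ n` with "EITHER `d ∉ {1, n}` and `d ∈ N(K^×)` OR `2d ∈ N(K^×)`"
  (`IsNormFrom K x := ∃ z : K, Algebra.norm ℚ z = x`, the printed global norms). Justification from
  the printed notation paragraph alone: when `h₄(n) = 1` the `2`-to-`1` map `θ` with kernel `{1, n}`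
  has `𝒟 ∩ N(K^×) = {1, n, d₁, d₂}` (`𝒟` = square-free divisors of `|D| = 4n`, i.e. of `2n`, `n`
  being odd), so the admissible `d` of the binder are exactly the odd parts `d₁', d₂'`, whose
  product is `n`; and since `n ≡ 1 (mod 8)` and `d₁' ≡ d₂' ≡ 1 (mod 4)`, `d₁' ≡ d₂' (mod 8)`
  (`oddPart_congr_mod_eight`, PROVED), so the printed "maximal" is immaterial to condition (i). The
  same universal form is PRINTED by S. Zhang, arXiv:2111.11618, Thm. 1.1 (restating Wang's Thm. 1):
  "Here, either `d ≠ 1, n` is a positive divisor of `n` such that `(d, −n)_v = 1, ∀ v`, or `d` is a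
  positive divisor of `n` such that `(2d, −n)_v = 1, ∀ v`" (everywhere-local norms = global norms
  for the quadratic extension `K/ℚ`, Hasse). [ZhangS2021NonCongruentTameKernel]

No `_holds` is expected. Consumers take `(h : thm1_h8_parity_iff_rank_zero_sha_two_by_two)`.

## References
* [Wang2016CongruentSha] Z. Wang, Sci. China Math. 59 (2016) 2145–2166 = arXiv:1511.03810: §1
  notation (chunk p0003 L14), Thm. 1 (p0003 L18–L23), Thm. 2 (p0003 L47–L60), Lemma 4
  (p0010 L20–L22), proof of Thm. 1 (p0010 L72 – p0011 L100).
* [ZhangS2021NonCongruentTameKernel] S. Zhang, arXiv:2111.11618, Thm. 1.1 (chunk p0003 L44–L52).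
* [BurungaleTian2026, Thm. 1.1], [BurungaleFlach2024, Cor. 2]: the refereed facts of §3, through
  the tree glue `bsdTriple_of_hasCM_of_mordellWeilRank_eq_zero_of_finite_shaPrimary`.
-/

noncomputable section

open NumberField WeierstrassCurve Literature.NumberTheory.EllipticCurves

namespace Literature.NumberTheory.EllipticCurves.Wang2016

/-! ### §1. Vocabulary (definitions with bodies; nothing asserted) -/

/-- The printed `8`-rank `h₈ = rank_{𝔽₂} 4𝒜/8𝒜` of a finite abelian group `𝒜` (multiplicative
notation), as `log₂ #(𝒜[2] ∩ 4𝒜)` = `log₂ (eightTwoCard 𝒜)` (exact, the count being a power of `2`);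
only its parity enters Thm. 1 (i). [cite: Wang2016CongruentSha, §1 notation (arXiv:1511.03810 chunk p0003 L14)] -/
def eightRank (A : Type*) [CommGroup A] : ℕ :=
  Nat.log 2 (eightTwoCard A)

/-- Unfolding of `eightRank` (by definition). [cite: Wang2016CongruentSha, §1 notation (chunk p0003 L14)] -/
theorem eightRank_def (A : Type*) [CommGroup A] : eightRank A = Nat.log 2 (eightTwoCard A) := rfl

/-- "`x ∈ N(K^×)`": the rational number `x` is a norm from the number field `K` (the printed
"image of the norm map from `K^×` to `ℚ^×`"; for `x ≠ 0` any witness is automatically non-zero).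
[cite: Wang2016CongruentSha, §1 notation (chunk p0003 L14)] -/
def IsNormFrom (K : Type*) [Field K] [NumberField K] (x : ℚ) : Prop :=
  ∃ z : K, Algebra.norm ℚ z = x

/-- Unfolding of `IsNormFrom` (by definition). [cite: Wang2016CongruentSha, §1 notation (chunk p0003 L14)] -/
theorem isNormFrom_iff (K : Type*) [Field K] [NumberField K] (x : ℚ) :
    IsNormFrom K x ↔ ∃ z : K, Algebra.norm ℚ z = x := Iff.rfl

/-! ### §2. The named fact: Wang 2016, Theorem 1 (nothing asserted) -/

/-- **Wang 2016, Theorem 1** (verbatim in the module docstring): for `n` a square-free positive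
integer, `n ≡ 1 (mod 8)`, all prime factors `≡ 1 (mod 4)`, `h₄(n) = 1` (`h₄, h₈` of the class group
of `K = ℚ(√−n)`, read in any quadratic field `K ∋ √−n`), and `d` the genus-theory divisor — typed,
as explained in the module docstring (and as printed by S. Zhang 2021, Thm. 1.1), as ANY divisor `d`
of `n` with either `d ∉ {1, n}` and `d ∈ N(K^×)`, or `2d ∈ N(K^×)` —: (i) `h₈(n) ≡ (d−1)/4 (mod 2)`
⟺ (ii) `rank_ℤ E_n(ℚ) = 0` and `Ш(E_n/ℚ)[2^∞] ≃ (ℤ/2ℤ)²` (`E_n = congruentNumberCurve n`,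
`Ш[2^∞]` = the `2`-primary component of the tree's `Ш`). A THEOREM of the source (JOURNAL),
vendored as a named fact; algebraic, no `L`-value; no `_holds` expected.
[cite: Wang2016CongruentSha, Thm. 1 (arXiv:1511.03810 chunk p0003 L18–L23) with the notation paragraph (chunk p0003 L14); proof §4.1 (chunk p0010 L72 – p0011 L100)] [cite: ZhangS2021NonCongruentTameKernel, Thm. 1.1 (arXiv:2111.11618 chunk p0003 L44–L52)] -/
def thm1_h8_parity_iff_rank_zero_sha_two_by_two : Prop :=
  ∀ (n : ℕ), Squarefree n → n % 8 = 1 → (∀ p ∈ n.primeFactors, p % 4 = 1) →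
    ∀ (K : Type) [Field K] [NumberField K], Tian2014.IsQuadraticFieldOfSqrt K (-(n : ℤ)) →
      Tian2014.fourTwoCard (ClassGroup (𝓞 K)) = 2 →
      ∀ (d : ℕ), d ∣ n →
        ((d ≠ 1 ∧ d ≠ n ∧ IsNormFrom K d) ∨ IsNormFrom K (2 * d)) →
          (eightRank (ClassGroup (𝓞 K)) % 2 = ((d - 1) / 4) % 2 ↔
            ((congruentNumberCurve n).mordellWeilRank = 0 ∧
              Nonempty (AddCommGroup.primaryComponent (congruentNumberCurve n).sha 2 ≃+
                ZMod 2 × ZMod 2)))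

/-! ### §3. Bookkeeping PROVED (no new fact): the immaterial "max", and the door at `p = 2` -/

/-- The "maximal" in the printed `d(n) = max(d₁', d₂')` is immaterial to Thm. 1 (i): if
`d · d' = n ≡ 1 (mod 8)` with `d ≡ d' ≡ 1 (mod 4)` then `d ≡ d' (mod 8)`, hence
`(d−1)/4 ≡ (d'−1)/4 (mod 2)`. Pure arithmetic. [cite: Wang2016CongruentSha, §1 notation (chunk p0003 L14)] -/
theorem oddPart_congr_mod_eight {n d d' : ℕ} (h : d * d' = n) (hn : n % 8 = 1) (hd : d % 4 = 1)
    (hd' : d' % 4 = 1) : ((d - 1) / 4) % 2 = ((d' - 1) / 4) % 2 := by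
  subst h
  have hmul : (d * d') % 8 = ((d % 8) * (d' % 8)) % 8 := Nat.mul_mod d d' 8
  rw [hmul] at hn
  have hd8 : d % 8 = 1 ∨ d % 8 = 5 := by omega
  have hd8' : d' % 8 = 1 ∨ d' % 8 = 5 := by omega
  rcases hd8 with h1 | h1 <;> rcases hd8' with h2 | h2 <;> simp [h1, h2] at hn <;> omega

/-- **Thm. 1 (i) ⟹ (ii), instances supplied**: on Wang's Thm. 1 family with the genus criterion,
`E_n` has Mordell–Weil rank `0` and `Ш(E_n/ℚ)[2^∞]` is FINITE of order `4` (transport along the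
printed isomorphism with `(ℤ/2)²`). [cite: Wang2016CongruentSha, Thm. 1 (chunk p0003 L18–L23)] -/
theorem rank_zero_and_card_shaTwo_of_thm1 (h : thm1_h8_parity_iff_rank_zero_sha_two_by_two)
    {n : ℕ} (hsq : Squarefree n) (hn8 : n % 8 = 1) (h4p : ∀ p ∈ n.primeFactors, p % 4 = 1)
    (K : Type) [Field K] [NumberField K] (hK : Tian2014.IsQuadraticFieldOfSqrt K (-(n : ℤ)))
    (h4 : Tian2014.fourTwoCard (ClassGroup (𝓞 K)) = 2) {d : ℕ} (hd : d ∣ n)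
    (hnorm : (d ≠ 1 ∧ d ≠ n ∧ IsNormFrom K d) ∨ IsNormFrom K (2 * d))
    (hi : eightRank (ClassGroup (𝓞 K)) % 2 = ((d - 1) / 4) % 2) :
    (congruentNumberCurve n).mordellWeilRank = 0 ∧
      Finite (AddCommGroup.primaryComponent (congruentNumberCurve n).sha 2) ∧
      Nat.card (AddCommGroup.primaryComponent (congruentNumberCurve n).sha 2) = 4 := by
  obtain ⟨hr, ⟨e⟩⟩ := (h n hsq hn8 h4p K hK h4 d hd hnorm).mp hi
  refine ⟨hr, Finite.of_equiv _ e.toEquiv.symm, ?_⟩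
  rw [Nat.card_congr e.toEquiv, Nat.card_prod, Nat.card_zmod]

/-- **The door at `p = 2` on the Thm. 1 class**: Wang 2016 Thm. 1 + Burungale–Tian 2026 Thm. 1.1
(the rank-zero `2`-converse) + Deuring–Hecke + Burungale–Flach 2024 Cor. 2 — all as the tree's
named facts, explicit binders — give the FULL BSD formula (RANK ∧ SHAFIN ∧ LEAD, `BSDTriple`) for
`congruentNumberCurve n` on {`n` square-free, `n ≡ 1 (8)`, all `p ∣ n` `≡ 1 (mod 4)`, `h₄(n) = 1`,
`h₈(n) ≡ (d−1)/4 (mod 2)` for a genus divisor `d`}, together with rank `0` and `#Ш(E_n)[2^∞] = 4`;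
via the tree glue `bsdTriple_of_hasCM_of_mordellWeilRank_eq_zero_of_finite_shaPrimary` at `p = 2`
(`E_n` has CM by `ℤ[i]`: `LiLiuTian2024.hasCM_congruentNumberCurve`). The class contains the
sibling's Thm. 3 class (`bsdTriple_of_thm3`). Nothing asserted.
[cite: Wang2016CongruentSha, Thm. 1 (chunk p0003 L18–L23)] [cite: BurungaleTian2026, Thm. 1.1]
[cite: BurungaleFlach2024, Thm. 1.1 and Cor. 2] -/
theorem bsdTriple_of_thm1 (h : thm1_h8_parity_iff_rank_zero_sha_two_by_two)
    (hBT : burungaleTian_analyticRank_eq_zero_of_selmerCorank_eq_zero_of_hasCM)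
    (hH : hasEntireLFunction_of_j_mem_maximalCMJInvariants)
    (hBF : bsdTriple_of_hasCM_of_L_one_ne_zero) {n : ℕ} (hsq : Squarefree n) (hn8 : n % 8 = 1)
    (h4p : ∀ p ∈ n.primeFactors, p % 4 = 1) (K : Type) [Field K] [NumberField K]
    (hK : Tian2014.IsQuadraticFieldOfSqrt K (-(n : ℤ)))
    (h4 : Tian2014.fourTwoCard (ClassGroup (𝓞 K)) = 2) {d : ℕ} (hd : d ∣ n)
    (hnorm : (d ≠ 1 ∧ d ≠ n ∧ IsNormFrom K d) ∨ IsNormFrom K (2 * d))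
    (hi : eightRank (ClassGroup (𝓞 K)) % 2 = ((d - 1) / 4) % 2) :
    haveI := isElliptic_congruentNumberCurve (Squarefree.ne_zero hsq)
    haveI := isGloballyMinimal_congruentNumberCurve hsq
    (congruentNumberCurve n).BSDTriple ∧ (congruentNumberCurve n).mordellWeilRank = 0 ∧
      Nat.card (AddCommGroup.primaryComponent (congruentNumberCurve n).sha 2) = 4 := by
  haveI := isElliptic_congruentNumberCurve (Squarefree.ne_zero hsq)
  haveI := isGloballyMinimal_congruentNumberCurve hsq
  obtain ⟨hr, hfin, hcard⟩ := rank_zero_and_card_shaTwo_of_thm1 h hsq hn8 h4p K hK h4 hd hnorm hi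
  haveI := hfin
  exact ⟨bsdTriple_of_hasCM_of_mordellWeilRank_eq_zero_of_finite_shaPrimary hBT hH hBF
    (congruentNumberCurve n) (LiLiuTian2024.hasCM_congruentNumberCurve n) 2 hr hfin, hr, hcard⟩

/-- **`BSD(E_n, ℓ)` for every prime `ℓ` on Wang's Thm. 1 family** (Miller's `BSDp`, the sub-lane's
predicate; in particular `ℓ = 2`, where `#Ш(E_n)[2^∞] = 4`), via the tree's
`forall_bsdp_of_bsdTriple'`. [cite: Wang2016CongruentSha, Thm. 1] [cite: BurungaleTian2026, Thm. 1.1]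
[cite: BurungaleFlach2024, Thm. 1.1 and Cor. 2] [cite: Miller2011LMS, §1 and Def. 1.1] -/
theorem forall_bsdp_of_thm1 (h : thm1_h8_parity_iff_rank_zero_sha_two_by_two)
    (hBT : burungaleTian_analyticRank_eq_zero_of_selmerCorank_eq_zero_of_hasCM)
    (hH : hasEntireLFunction_of_j_mem_maximalCMJInvariants)
    (hBF : bsdTriple_of_hasCM_of_L_one_ne_zero) {n : ℕ} (hsq : Squarefree n) (hn8 : n % 8 = 1)
    (h4p : ∀ p ∈ n.primeFactors, p % 4 = 1) (K : Type) [Field K] [NumberField K]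
    (hK : Tian2014.IsQuadraticFieldOfSqrt K (-(n : ℤ)))
    (h4 : Tian2014.fourTwoCard (ClassGroup (𝓞 K)) = 2) {d : ℕ} (hd : d ∣ n)
    (hnorm : (d ≠ 1 ∧ d ≠ n ∧ IsNormFrom K d) ∨ IsNormFrom K (2 * d))
    (hi : eightRank (ClassGroup (𝓞 K)) % 2 = ((d - 1) / 4) % 2) (ℓ : ℕ) (hℓ : ℓ.Prime) :
    haveI := isElliptic_congruentNumberCurve (Squarefree.ne_zero hsq)
    haveI := isGloballyMinimal_congruentNumberCurve hsq
    BSDp (congruentNumberCurve n) ℓ :=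
  haveI := isElliptic_congruentNumberCurve (Squarefree.ne_zero hsq)
  haveI := isGloballyMinimal_congruentNumberCurve hsq
  forall_bsdp_of_bsdTriple' _ (bsdTriple_of_thm1 h hBT hH hBF hsq hn8 h4p K hK h4 hd hnorm hi).1 ℓ hℓ

/-- **The sibling's Thm. 3 door is the `h₈(n) = 0` corner of the same picture**: on the Thm. 3
class (all `p ∣ n` `≡ 1 (mod 8)`, `h₄(n) = 1`, `δ_n` odd) one has `h₈(n) = 0`, i.e.
`eightRank = 0` — read off the sibling's fact, (i) ⟺ (ii) — so Thm. 1's parity condition holds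
there with any genus divisor `d ≡ 1 (mod 8)`. Recorded as the PROVED implication
"Thm. 3 hypotheses ⟹ `eightRank (Cl K) = 0`". [cite: Wang2016CongruentSha, Thm. 3 (ii) (chunk p0011 L129)] -/
theorem eightRank_eq_zero_of_thm3 (h : thm3_rank_zero_and_sha_two_by_two) {n : ℕ}
    (hsq : Squarefree n) (h8 : ∀ p ∈ n.primeFactors, p % 8 = 1) (K : Type) [Field K]
    [NumberField K] (hK : Tian2014.IsQuadraticFieldOfSqrt K (-(n : ℤ)))
    (h4 : Tian2014.fourTwoCard (ClassGroup (𝓞 K)) = 2) (hδ : Odd (deltaCount n)) :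
    eightRank (ClassGroup (𝓞 K)) = 0 := by
  rw [eightRank, ((h n hsq h8 K hK h4).1).mp hδ]
  simp

end Literature.NumberTheory.EllipticCurves.Wang2016

end
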